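import Mathlib
import Summits.NavierStokesRegularity.NavierStokesRegularity.Theses.FilamentPinchDoor
import Summits.NavierStokesRegularity.NavierStokesRegularity.Theorems.ImplosionDoorImplosionZoomFading
import Summits.NavierStokesRegularity.NavierStokesRegularity.Theorems.LocalSineTubeDoorProfileAlignedWindowRigidityAncient
import Literature.Analysis.FluidPDE.TypeIAncientMild
import Literature.Analysis.FluidPDE.MildSolution
import Literature.Analysis.FluidPDE.TaoEnstrophyLocalisation
import Summits.NavierStokesRegularity.NavierStokesRegularity.Theorems.LocalIrrotationalScarDoorZoomFrameSuitable
import Summits.NavierStokesRegularity.NavierStokesRegularity.Theorems.LocalSineTubeDoorLocalPointZoomSlices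
import Literature.Analysis.FluidPDE.LocalTypeICongr
import HarnessLib

/-!
# `FilamentPinchDoor.SuitableHalfSpaceZoom` — the energy-class half-space zoom
  (item stmt-NavierStokesRegularity-26432, route `FilamentPinchDoor`, support, rank 9)

**Statement (verbatim route decl).** Under the frame and local Type-I hypotheses of the door leaf
`HalfSpaceWindowDoor.Target`, all-window mean-square fading of the negative part of `⟪(T−t)ω, e⟫` in similarity
variables and failure of backward boundedness at `(x₀,T)` yield `C`, a profile `v` of the Type-I ancient Oseen-mild
class (rate, continuity, Oseen identity, divergence free) which is ALSO a suitable weak solution on the backward slab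
with a weak spatial gradient `H`, pressure `π` and Albritton–Barker's `𝐈(ℝ₋ × ℝ³) < ∞`, backward singular at
`(0,0)`, with `⟪curl v(s) y, e⟫ ≥ 0` for all `s < 0`, `y`.

PROOF = plumbing over landed theorems (prover seat `ns-el-k1b` g0, director-ns #184 (2b)):
* `LocalIrrotationalScarDoorZoomFrameSuitable.localTreeZoomFrame_suitable` (p6 lineage): the tree zoom frame at a
  locally Type-I point WITH the suitable-weak data of its `L³_loc` limit `w` — pressure `ϖ`, weak gradient `H`,
  `IsSuitableWeakSolutionOn (slab) 1 0 w ϖ`, `HasWeakSpatialGradientOn (slab) w H`, `typeIBound (ℝ₋ × ℝ³) w ϖ H < ⊤` —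
  AND `w = v₁` a.e. on the slab with `v₁` in the profile class, backward singular, the zooms identified with `u`;
* `curl_tendsto_of_frame` (this file) — the `σ = √(−s)` parabolic rescaling of
  `LocalSineTubeDoorLocalPointZoomSlices.localPointZoomSlices`, run on the components of ANY such frame
  (`LocalSineTubeDoorLocalPointZoomCurl.localZoomFrame_curl_tendsto` is component-based): vorticity-slice
  convergence `((Rλⱼ/2)²/ν)·ω(T + (Rλⱼ/2)² s/ν, x₀ + (Rλⱼ/2) y) → curl v₁(s, y)` for every `s < 0`, `y`;
* `inner_curl_nonneg_of_fading` (this file) — the fading argument of `halfSpaceWindowDoor_halfSpaceZoom_proof`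
  (`ZoomFading.nonneg_of_fading_negPart`: Fatou + continuity of the analytic slices) on components: `⟪curl v₁(s) y, e⟫ ≥ 0`;
* transfer of the slab data from `w` to `v₁` by a.e. invariance (`IsSuitableWeakSolutionOn.congr_ae`,
  `HasWeakSpatialGradientOn.congr_ae`, `typeIBound_congr_ae`, `coe_slab`).

HONEST FRAMING: a compactness/bookkeeping lemma about a HYPOTHETICAL locally Type-I blow-up (support item of a
door route); none of the route's cruxes (26430, 26431, 19708) is touched; nothing here bears on NS regularity.
-/

noncomputable section

set_option linter.dupNamespace false

namespace Summit.NavierStokesRegularity.NavierStokesRegularity.Theorems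

open MeasureTheory Set Filter Topology Metric Function
open Literature.Analysis Literature.Analysis.FluidPDE Literature.Analysis.FluidPDE.SereginSverak2009
open scoped RealInnerProductSpace InnerProductSpace ENNReal NNReal

namespace FilamentPinchDoorSuitableHalfSpaceZoom

open Summit.NavierStokesRegularity.NavierStokesRegularity.Theorems.LocalSineTubeDoorLocalPointZoomFrame
open Summit.NavierStokesRegularity.NavierStokesRegularity.Theorems.LocalSineTubeDoorLocalPointZoomCurl
open Summit.NavierStokesRegularity.NavierStokesRegularity.Theorems.LocalSineTubeDoorLocalPointZoomSlices
open Summit.NavierStokesRegularity.NavierStokesRegularity.Theorems.LocalSineTubeDoorLocalPointZoomZoom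
open Summit.NavierStokesRegularity.NavierStokesRegularity.Theorems.LocalSineTubeDoorProfileAlignedWindowRigidityAncient
open ZoomFading

/-- **Vorticity-slice convergence from the components of a zoom frame** (the body of
`LocalSineTubeDoorLocalPointZoomSlices.localPointZoomSlices`, stated on components so that it applies to the frame
of `localTreeZoomFrame_suitable` as well): for every `s < 0` and `y`,
`((Rλⱼ/2)²/ν) · curl u(T + (Rλⱼ/2)² s/ν)(x₀ + (Rλⱼ/2) y) → curl v₁(s)(y)`. [cite: AlbrittonBarker2019, §2; KochNadirashviliSereginSverak2009, §5–6] -/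
theorem curl_tendsto_of_frame {ν T : ℝ} (hν : 0 < ν) (hT : 0 < T)
    {u : ℝ → (EuclideanSpace ℝ (Fin 3)) → (EuclideanSpace ℝ (Fin 3))} {p : ℝ → (EuclideanSpace ℝ (Fin 3)) → ℝ}
    (hsol : IsClassicalNSSolutionOn (Ico 0 T) ν 0 u p)
    {x₀ : (EuclideanSpace ℝ (Fin 3))} {ρ M : ℝ} (hρ : 0 < ρ)
    (hM : ∀ t ∈ Ico 0 T, T - ρ ^ 2 < t → ∀ x ∈ ball x₀ ρ, ‖u t x‖ * Real.sqrt (ν * (T - t)) ≤ M)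
    {R : ℝ} (hR : 0 < R) {v' : ℝ → (EuclideanSpace ℝ (Fin 3)) → (EuclideanSpace ℝ (Fin 3))} {π' : ℝ → (EuclideanSpace ℝ (Fin 3)) → ℝ}
    (hball1 : IsSuitableWeakSolutionInBall 1 0 v' π') {lam : ℕ → ℝ} (hlam : ∀ j, 0 < lam j)
    (hlam0 : Tendsto lam atTop (𝓝 0)) {Ks : ℝ≥0} {r₁ : ℝ} (hr₁ : 0 < r₁) (hr₁1 : r₁ ≤ 1)
    (hKs : ∀ r ∈ Ioc (0 : ℝ) r₁, cknD r (0 : ℝ × (EuclideanSpace ℝ (Fin 3))) π' ≤ Ks)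
    (hpt : ∀ (j : ℕ) (s : ℝ) (y : (EuclideanSpace ℝ (Fin 3))), ((lam j) • stPull ((lam j) ^ 2) (lam j) (0 : ℝ) (0 : (EuclideanSpace ℝ (Fin 3))) v') s y =
      ((R * (lam j / 2)) / ν) • u (T + (R * (lam j / 2)) ^ 2 * s / ν) (x₀ + (R * (lam j / 2)) • y))
    {w v₁ : ℝ → (EuclideanSpace ℝ (Fin 3)) → (EuclideanSpace ℝ (Fin 3))}
    (hL3 : ∀ a : ℝ, 0 < a → Tendsto (fun j => eLpNorm (uncurry ((lam j) • stPull ((lam j) ^ 2) (lam j) (0 : ℝ) (0 : (EuclideanSpace ℝ (Fin 3))) v') - uncurry w) 3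
      (volume.restrict (parabolicCylinder a (0 : ℝ × (EuclideanSpace ℝ (Fin 3)))))) atTop (𝓝 0))
    (hae : ∀ᵐ x ∂(volume.restrict (Iio (0 : ℝ) ×ˢ (univ : Set (EuclideanSpace ℝ (Fin 3))))), uncurry w x = uncurry v₁ x)
    {C₁ : ℝ} (hP : HasTypeITimeDecay C₁ v₁ ∧ ContinuousOn (uncurry v₁) (Iio (0 : ℝ) ×ˢ univ) ∧
      (∀ s t : ℝ, s < t → t < 0 → ∀ x,
        v₁ t x = UnboundedOperators.heatExtension (v₁ s) (t - s) x - oseenDuhamel 1 s v₁ v₁ t x) ∧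
      (∀ t < 0, VectorCalculus.IsDivFree (v₁ t)))
    (s : ℝ) (hs : s < 0) (y : (EuclideanSpace ℝ (Fin 3))) :
    Tendsto (fun j => ((R * (lam j / 2)) ^ 2 / ν) •
        curl (u (T + (R * (lam j / 2)) ^ 2 * s / ν)) (x₀ + (R * (lam j / 2)) • y)) atTop
      (𝓝 (curl (v₁ s) y)) := by
  -- ## the scaling factor `σ = √(−s)`
  have hns : 0 < -s := neg_pos.2 hs
  set σ : ℝ := Real.sqrt (-s) with hσdef
  have hσ : 0 < σ := Real.sqrt_pos.2 hns
  have hσ2 : σ ^ 2 = -s := Real.sq_sqrt hns.le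
  have hσne : σ ≠ 0 := hσ.ne'
  -- ## the rescaled frame
  set lam' : ℕ → ℝ := fun j => σ * lam j with hlam'def
  have hlam' : ∀ j, 0 < lam' j := fun j => mul_pos hσ (hlam j)
  have hlam0' : Tendsto lam' atTop (𝓝 0) := by
    show Tendsto (fun j => σ * lam j) atTop (𝓝 0)
    simpa using hlam0.const_mul σ
  set w' : ℝ → (EuclideanSpace ℝ (Fin 3)) → (EuclideanSpace ℝ (Fin 3)) := σ • stPull (σ ^ 2) σ (0 : ℝ) (0 : (EuclideanSpace ℝ (Fin 3))) w with hw'def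
  set v₁' : ℝ → (EuclideanSpace ℝ (Fin 3)) → (EuclideanSpace ℝ (Fin 3)) := σ • stPull (σ ^ 2) σ (0 : ℝ) (0 : (EuclideanSpace ℝ (Fin 3))) v₁ with hv₁'def
  have hZZ : ∀ j, (lam' j) • stPull ((lam' j) ^ 2) (lam' j) (0 : ℝ) (0 : (EuclideanSpace ℝ (Fin 3))) v' =
      σ • stPull (σ ^ 2) σ (0 : ℝ) (0 : (EuclideanSpace ℝ (Fin 3)))
        ((lam j) • stPull ((lam j) ^ 2) (lam j) (0 : ℝ) (0 : (EuclideanSpace ℝ (Fin 3))) v') := by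
    intro j
    simp only [hlam'def]
    rw [zoom_zoom]
  -- (pt') identification with the zooms of `u` at the scales `R σλⱼ/2`
  have hpt' : ∀ (j : ℕ) (s' : ℝ) (y' : (EuclideanSpace ℝ (Fin 3))),
      ((lam' j) • stPull ((lam' j) ^ 2) (lam' j) (0 : ℝ) (0 : (EuclideanSpace ℝ (Fin 3))) v') s' y' =
        ((R * (lam' j / 2)) / ν) • u (T + (R * (lam' j / 2)) ^ 2 * s' / ν) (x₀ + (R * (lam' j / 2)) • y') := by
    intro j s' y'
    have h := hpt j (σ ^ 2 * s') (σ • y')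
    simp only [smul_stPull_apply, zero_add] at h ⊢
    simp only [hlam'def]
    rw [show (σ * lam j) ^ 2 * s' = lam j ^ 2 * (σ ^ 2 * s') by ring,
      show (σ * lam j) • y' = lam j • σ • y' by rw [smul_smul, mul_comm],
      mul_smul, h, smul_smul, smul_smul,
      show σ * (R * (lam j / 2) / ν) = R * (σ * lam j / 2) / ν by ring,
      show T + (R * (lam j / 2)) ^ 2 * (σ ^ 2 * s') / ν = T + (R * (σ * lam j / 2)) ^ 2 * s' / ν by ring,
      show R * (lam j / 2) * σ = R * (σ * lam j / 2) by ring]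
  -- (L3') local `L³` convergence of the rescaled zooms to `w'`
  have hus : ∀ f g : ℝ → (EuclideanSpace ℝ (Fin 3)) → (EuclideanSpace ℝ (Fin 3)), uncurry (f - g) = uncurry f - uncurry g := fun f g => rfl
  have hL3' : ∀ a : ℝ, 0 < a → Tendsto (fun j => eLpNorm
      (uncurry ((lam' j) • stPull ((lam' j) ^ 2) (lam' j) (0 : ℝ) (0 : (EuclideanSpace ℝ (Fin 3))) v') - uncurry w') 3
      (volume.restrict (parabolicCylinder a (0 : ℝ × (EuclideanSpace ℝ (Fin 3)))))) atTop (𝓝 0) := by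
    intro a ha
    have hdiff : ∀ j, uncurry ((lam' j) • stPull ((lam' j) ^ 2) (lam' j) (0 : ℝ) (0 : (EuclideanSpace ℝ (Fin 3))) v') -
        uncurry w' = uncurry (σ • stPull (σ ^ 2) σ (0 : ℝ) (0 : (EuclideanSpace ℝ (Fin 3)))
          ((lam j) • stPull ((lam j) ^ 2) (lam j) (0 : ℝ) (0 : (EuclideanSpace ℝ (Fin 3))) v' - w)) := by
      intro j
      rw [hZZ j]
      funext z
      obtain ⟨s', y'⟩ := z
      simp only [hw'def, uncurry_apply_pair, Pi.sub_apply, smul_stPull_apply, smul_sub]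
    have hconst : (‖σ‖ₑ * (ENNReal.ofReal ((σ ^ 2 * σ ^ 3)⁻¹)) ^ (1 / (3 : ℝ≥0∞).toReal)) ≠ ⊤ :=
      ENNReal.mul_ne_top enorm_ne_top
        (ENNReal.rpow_ne_top_of_nonneg (one_div_nonneg.2 ENNReal.toReal_nonneg) ENNReal.ofReal_ne_top)
    have key := ENNReal.Tendsto.const_mul (hL3 (a * σ) (mul_pos ha hσ)) (Or.inr hconst)
    rw [mul_zero] at key
    refine key.congr fun j => ?_
    rw [hdiff j]
    conv_rhs => rw [show a = a * σ / σ by field_simp]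
    rw [eLpNorm_uncurry_zoom hσ σ _ (a * σ) three_ne_zero ENNReal.ofNat_ne_top, hus]
  -- (ae') the rescaled limit agrees a.e. with the rescaled profile
  have hslab : stAffine (σ ^ 2) σ (0 : ℝ) (0 : (EuclideanSpace ℝ (Fin 3))) ⁻¹' (Iio (0 : ℝ) ×ˢ (univ : Set (EuclideanSpace ℝ (Fin 3)))) =
      Iio (0 : ℝ) ×ˢ (univ : Set (EuclideanSpace ℝ (Fin 3))) := by
    ext z
    simp only [mem_preimage, mem_prod, mem_Iio, mem_univ, and_true, stAffine_fst, zero_add]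
    exact ⟨fun h => neg_of_mul_neg_right h (pow_pos hσ 2).le,
      fun h => mul_neg_of_pos_of_neg (pow_pos hσ 2) h⟩
  have hae' : ∀ᵐ x ∂(volume.restrict (Iio (0 : ℝ) ×ˢ (univ : Set (EuclideanSpace ℝ (Fin 3))))),
      uncurry w' x = uncurry v₁' x := by
    have h := ae_eq_restrict_comp_stAffine (f := uncurry w) (g := uncurry v₁) (pow_pos hσ 2) hσ
      (0 : ℝ) (0 : (EuclideanSpace ℝ (Fin 3))) hae
    rw [hslab] at h
    filter_upwards [h] with z hz
    show σ • uncurry w (stAffine (σ ^ 2) σ (0 : ℝ) (0 : (EuclideanSpace ℝ (Fin 3))) z) =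
      σ • uncurry v₁ (stAffine (σ ^ 2) σ (0 : ℝ) (0 : (EuclideanSpace ℝ (Fin 3))) z)
    rw [show uncurry w (stAffine (σ ^ 2) σ (0 : ℝ) (0 : (EuclideanSpace ℝ (Fin 3))) z) =
      uncurry v₁ (stAffine (σ ^ 2) σ (0 : ℝ) (0 : (EuclideanSpace ℝ (Fin 3))) z) from hz]
  -- (P') the rescaled profile is in the class (scaling invariance of rate / continuity / mildness)
  have hrate' : HasTypeITimeDecay C₁ v₁' := rate_smul_stPull hP.1 hσ
  have hcont' : ContinuousOn (uncurry v₁') (Iio (0 : ℝ) ×ˢ univ) := cont_smul_stPull hP.2.1 hσ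
  have hmild' := mild_smul_stPull hP.2.2.1 hσ
  -- ## the interior upgrade at time `−1` of the rescaled frame
  have key := localZoomFrame_curl_tendsto hν hT hsol.smooth_velocity.continuousOn hρ hM hR hball1 hlam'
    hlam0' hr₁ hr₁1 hKs hpt' hL3' hae' hrate' hcont' hmild' (σ⁻¹ • y)
  -- ## identification of the terms
  have hcurlZ : ∀ j, curl (((lam' j) • stPull ((lam' j) ^ 2) (lam' j) (0 : ℝ) (0 : (EuclideanSpace ℝ (Fin 3))) v') (-1))
      (σ⁻¹ • y) = (-s) • (((R * (lam j / 2)) ^ 2 / ν) •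
        curl (u (T + (R * (lam j / 2)) ^ 2 * s / ν)) (x₀ + (R * (lam j / 2)) • y)) := by
    intro j
    have hfun : ((lam' j) • stPull ((lam' j) ^ 2) (lam' j) (0 : ℝ) (0 : (EuclideanSpace ℝ (Fin 3))) v') (-1) =
        (((R * (lam' j / 2)) / ν) • stPull ((R * (lam' j / 2)) ^ 2 / ν) (R * (lam' j / 2)) T x₀ u)
          (-1) := by
      funext y'
      rw [hpt' j (-1) y', smul_stPull_apply]
      congr 2
      ring
    have e1 : R * (σ * lam j / 2) / ν * (R * (σ * lam j / 2)) = (-s) * ((R * (lam j / 2)) ^ 2 / ν) := by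
      rw [← hσ2]; ring
    have e2 : T + (R * (σ * lam j / 2)) ^ 2 / ν * (-1) = T + (R * (lam j / 2)) ^ 2 * s / ν := by
      have hs' : s = -σ ^ 2 := by rw [hσ2]; ring
      rw [hs']; ring
    have e3 : R * (σ * lam j / 2) * σ⁻¹ = R * (lam j / 2) := by
      calc R * (σ * lam j / 2) * σ⁻¹ = R * (lam j / 2) * (σ * σ⁻¹) := by ring
        _ = R * (lam j / 2) := by rw [mul_inv_cancel₀ hσne, mul_one]
    rw [hfun, curl_smul_stPull]
    simp only [hlam'def, smul_smul]
    rw [e1, e2, e3]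
  have hlimit : curl (v₁' (-1)) (σ⁻¹ • y) = (-s) • curl (v₁ s) y := by
    simp only [hv₁'def]
    rw [curl_smul_stPull]
    simp only [smul_smul, mul_inv_cancel₀ hσne, one_smul, zero_add]
    rw [show σ ^ 2 * (-1) = s by rw [hσ2]; ring, show σ * σ = -s by rw [← hσ2]; ring]
  -- ## conclusion: divide by `−s`
  have key' : Tendsto (fun j => (-s) • (((R * (lam j / 2)) ^ 2 / ν) •
      curl (u (T + (R * (lam j / 2)) ^ 2 * s / ν)) (x₀ + (R * (lam j / 2)) • y))) atTop
      (𝓝 ((-s) • curl (v₁ s) y)) := by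
    rw [← hlimit]
    exact Tendsto.congr hcurlZ key
  have key3 := key'.const_smul (-s)⁻¹
  simp only [smul_smul, inv_mul_cancel₀ hns.ne', inv_mul_cancel_left₀ hns.ne', one_smul]
    at key3
  exact key3


/-- **Closed-hemisphere slices from window fading, on components** (the body of
`halfSpaceWindowDoor_halfSpaceZoom_proof`): if the rescaled vorticities at scales `μⱼ → 0⁺` converge on every slice to
`curl v(s)` for a profile `v` of the Type-I ancient Oseen-mild class, and the negative part of `⟪(T−t)ω, e⟫` fades in
mean square on every similarity window, then `⟪curl v(s) y, e⟫ ≥ 0`. [cite: AlbrittonBarker2019, §2; KochNadirashviliSereginSverak2009, §5–6] -/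
theorem inner_curl_nonneg_of_fading {ν T : ℝ} (hν : 0 < ν) (hT : 0 < T)
    {u : ℝ → (EuclideanSpace ℝ (Fin 3)) → (EuclideanSpace ℝ (Fin 3))} {p : ℝ → (EuclideanSpace ℝ (Fin 3)) → ℝ}
    (hsol : IsClassicalNSSolutionOn (Ico 0 T) ν 0 u p) {x₀ : (EuclideanSpace ℝ (Fin 3))}
    {C : ℝ} {v : ℝ → (EuclideanSpace ℝ (Fin 3)) → (EuclideanSpace ℝ (Fin 3))}
    (hrate : HasTypeITimeDecay C v) (hcont : ContinuousOn (uncurry v) (Iio (0 : ℝ) ×ˢ univ))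
    (hmild : ∀ s t : ℝ, s < t → t < 0 → ∀ x,
      v t x = UnboundedOperators.heatExtension (v s) (t - s) x - oseenDuhamel 1 s v v t x)
    (hdiv : ∀ t < 0, VectorCalculus.IsDivFree (v t))
    {lam : ℕ → ℝ} (hlam : ∀ j, 0 < lam j) (hlam0 : Tendsto lam atTop (𝓝 0))
    (hzoom : ∀ s < 0, ∀ y, Tendsto (fun j => (lam j ^ 2 / ν) •
      curl (u (T + lam j ^ 2 * s / ν)) (x₀ + lam j • y)) atTop (𝓝 (curl (v s) y)))
    {e : (EuclideanSpace ℝ (Fin 3))}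
    (hfade : ∀ R : ℝ, 0 < R → Tendsto (fun t => ∫⁻ y in ball (0 : (EuclideanSpace ℝ (Fin 3))) R,
      ENNReal.ofReal ((min (⟪(T - t) • curl (u t) (x₀ + Real.sqrt (T - t) • y), e⟫_ℝ) 0) ^ 2))
      (nhdsWithin T (Iio T)) (𝓝 0))
    (s : ℝ) (hs : s < 0) (y : (EuclideanSpace ℝ (Fin 3))) : 0 ≤ ⟪curl (v s) y, e⟫_ℝ := by
  -- the class is the tree's `IsTypeIAncientMild` (joint smoothness from joint analyticity),
  -- so the vorticity slice `curl v(s)` is continuous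
  have hA : IsTypeIAncientMild C v := by
    refine ⟨(analyticOnNhd_uncurry hcont (bdd_of_hasTypeITimeDecay hrate) hmild).contDiffOn_of_completeSpace,
      fun t ht => hdiv t ht, fun s t hst ht x => ?_, hrate⟩
    rw [heatFlow_of_pos _ (sub_pos.2 hst)]
    exact hmild s t hst ht x
  have hcurlv : Continuous (curl (v s)) := by
    have h1 : ContDiff ℝ 1 (v s) := (hA.contDiff_slice hs).of_le (by exact_mod_cast le_top)
    rw [curl_eq_curlCLM_comp]
    exact curlCLM.continuous.comp (h1.continuous_fderiv one_ne_zero)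
  -- the similarity factor `c = √(−s/ν)` and the zoom times `t_j = T + λ_j² s/ν → T⁻`
  have hsν : 0 < -s / ν := div_pos (neg_pos.2 hs) hν
  set c : ℝ := Real.sqrt (-s / ν) with hcdef
  have hc : 0 < c := Real.sqrt_pos.2 hsν
  set tj : ℕ → ℝ := fun j => T + lam j ^ 2 * s / ν with htjdef
  have htjT : ∀ j, tj j < T := fun j => by
    have : lam j ^ 2 * s / ν < 0 :=
      div_neg_of_neg_of_pos (mul_neg_of_pos_of_neg (pow_pos (hlam j) 2) hs) hν
    simp only [htjdef]; linarith
  have htj_sub : ∀ j, T - tj j = lam j ^ 2 * (-s / ν) := fun j => by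
    simp only [htjdef]; ring
  have hsqrt : ∀ j, Real.sqrt (T - tj j) = lam j * c := fun j => by
    rw [htj_sub, Real.sqrt_mul (sq_nonneg _), Real.sqrt_sq (hlam j).le]
  have htj_nhds : Tendsto tj atTop (𝓝 T) := by
    have h1 : Tendsto (fun j => T + lam j ^ 2 * s / ν) atTop (𝓝 (T + 0 ^ 2 * s / ν)) :=
      (((hlam0.pow 2).mul_const s).div_const ν).const_add T
    simpa using h1
  have htj_tend : Tendsto tj atTop (𝓝[<] T) :=
    tendsto_nhdsWithin_iff.2 ⟨htj_nhds, Eventually.of_forall htjT⟩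
  -- eventually the zoom times are physical: `t_j ∈ [0, T)`
  obtain ⟨N, hN⟩ : ∃ N : ℕ, ∀ j ≥ N, 0 ≤ tj j := by
    obtain ⟨N, hN⟩ := eventually_atTop.1 (htj_nhds.eventually (lt_mem_nhds hT))
    exact ⟨N, fun j hj => (hN j hj).le⟩
  have htjI : ∀ j, tj (j + N) ∈ Ico 0 T := fun j =>
    ⟨hN _ (Nat.le_add_left N j), htjT _⟩
  -- the door functionals along the (shifted) zoom times and their pointwise limit
  set F : ℕ → EuclideanSpace ℝ (Fin 3) → ℝ := fun j y' =>
    ⟪(T - tj (j + N)) • curl (u (tj (j + N))) (x₀ + Real.sqrt (T - tj (j + N)) • y'), e⟫_ℝ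
    with hFdef
  set g : EuclideanSpace ℝ (Fin 3) → ℝ := fun y' => ⟪(-s) • curl (v s) (c • y'), e⟫_ℝ with hgdef
  have hg : Continuous g := by
    have h1 : Continuous fun y' : EuclideanSpace ℝ (Fin 3) => c • y' := continuous_const_smul c
    have h2 : Continuous fun y' : EuclideanSpace ℝ (Fin 3) => curl (v s) (c • y') := hcurlv.comp h1
    exact (h2.const_smul (-s)).inner continuous_const
  have hF : ∀ j, Measurable (F j) := by
    intro j
    have huC : ContDiff ℝ 1 (u (tj (j + N))) :=
      (hsol.contDiff_velocity (htjI j)).of_le (by exact_mod_cast le_top)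
    have huc : Continuous (curl (u (tj (j + N)))) := by
      rw [curl_eq_curlCLM_comp]
      exact curlCLM.continuous.comp (huC.continuous_fderiv one_ne_zero)
    have h1 : Continuous fun y' : EuclideanSpace ℝ (Fin 3) =>
        x₀ + Real.sqrt (T - tj (j + N)) • y' :=
      continuous_const.add (continuous_const_smul _)
    exact (((huc.comp h1).const_smul (T - tj (j + N))).inner continuous_const).measurable
  have hlimF : ∀ y', Tendsto (fun j => F j y') atTop (𝓝 (g y')) := by
    intro y'
    -- the vorticity zoom at the point `c • y'`, shifted by `N`, scaled by `−s`, paired with `e`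
    have hz := ((hzoom s hs (c • y')).comp (tendsto_add_atTop_nat N)).const_smul (-s)
    have hz' := hz.inner (𝕜 := ℝ) (tendsto_const_nhds (x := e))
    refine hz'.congr fun j => ?_
    simp only [hFdef, Function.comp_apply]
    congr 1
    rw [hsqrt, smul_smul, mul_smul (lam (j + N)) c y', htj_sub]
    congr 1
    field_simp
  have hfadeF : ∀ R : ℝ, 0 < R → Tendsto (fun j => ∫⁻ y' in ball (0 : EuclideanSpace ℝ (Fin 3)) R,
      ENNReal.ofReal ((min (F j y') 0) ^ 2)) atTop (𝓝 0) := by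
    intro R hR
    exact ((hfade R hR).comp htj_tend).comp (tendsto_add_atTop_nat N)
  -- the fading lemma: `g ≥ 0`; read it at `y' = c⁻¹ • y`
  have hgy := nonneg_of_fading_negPart hg hF hlimF hfadeF (c⁻¹ • y)
  have hcy : c • c⁻¹ • y = y := by rw [smul_smul, mul_inv_cancel₀ hc.ne', one_smul]
  simp only [hgdef, hcy, real_inner_smul_left] at hgy
  exact (mul_nonneg_iff_of_pos_left (neg_pos.2 hs)).1 hgy

end FilamentPinchDoorSuitableHalfSpaceZoom

open FilamentPinchDoorSuitableHalfSpaceZoom LocalIrrotationalScarDoorZoomFrameSuitable in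
/-- **Item stmt-NavierStokesRegularity-26432** (`FilamentPinchDoor.SuitableHalfSpaceZoom`): the energy-class
half-space zoom — a profile of the Type-I ancient Oseen-mild class which is also a slab-suitable weak solution with
weak gradient and `𝐈 < ∞`, backward singular at the apex, with closed-hemisphere slices.
[cite: AlbrittonBarker2019, §2–3; KochNadirashviliSereginSverak2009, §5–6] -/
theorem filamentPinchDoor_suitableHalfSpaceZoom_proof :
    Summit.NavierStokesRegularity.NavierStokesRegularity.Theses.FilamentPinchDoor.SuitableHalfSpaceZoom := by
  unfold Summit.NavierStokesRegularity.NavierStokesRegularity.Theses.FilamentPinchDoor.SuitableHalfSpaceZoom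
  intro ν T hν hT u p hsol hLH _hdec x₀ ρ M hρ hM e _he hfade hnotbd
  obtain ⟨R, C₁, v', π', lam, w, v₁, ϖ, H, Ks, r₁, hR, hlam, hlam0, hball1, hr₁, hr₁1, hKs, hL3,
    ⟨hsw, hwg, hI, _hsingw, -, -⟩, hae, hP, hsing₁, hpt⟩ :=
    localTreeZoomFrame_suitable hν hT hsol hLH hρ hM hnotbd
  -- the slab data pass from `w` to its a.e.-equal continuous representative `v₁`
  have hae' : ∀ᵐ z ∂(volume.restrict ((slab (EuclideanSpace ℝ (Fin 3)) (Iio 0) isOpen_Iio :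
      TopologicalSpace.Opens (ℝ × (EuclideanSpace ℝ (Fin 3)))) : Set (ℝ × (EuclideanSpace ℝ (Fin 3))))), uncurry w z = uncurry v₁ z := by
    rw [coe_slab]
    exact hae
  have hsw₁ : IsSuitableWeakSolutionOn (slab (EuclideanSpace ℝ (Fin 3)) (Iio 0) isOpen_Iio) 1 0 v₁ ϖ :=
    hsw.congr_ae hae' (ae_of_all _ fun _ => rfl)
  have hwg₁ : HasWeakSpatialGradientOn (slab (EuclideanSpace ℝ (Fin 3)) (Iio 0) isOpen_Iio) v₁ H := hwg.congr_ae hae'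
  have hI₁ : typeIBound (Iio (0 : ℝ) ×ˢ univ) v₁ ϖ H < ⊤ := by
    rw [← typeIBound_congr_ae hae]; exact hI
  -- vorticity-slice convergence at the scales `μ_j = R λ_j / 2`
  set μ : ℕ → ℝ := fun j => R * (lam j / 2) with hμ
  have hμpos : ∀ j, 0 < μ j := fun j => mul_pos hR (half_pos (hlam j))
  have hμ0 : Tendsto μ atTop (𝓝 0) := by simpa [hμ] using (hlam0.div_const 2).const_mul R
  have hzoom : ∀ s < 0, ∀ y, Tendsto (fun j => (μ j ^ 2 / ν) •
      curl (u (T + μ j ^ 2 * s / ν)) (x₀ + μ j • y)) atTop (𝓝 (curl (v₁ s) y)) :=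
    fun s hs y => curl_tendsto_of_frame hν hT hsol hρ hM hR hball1 hlam hlam0 hr₁ hr₁1 hKs hpt hL3 hae hP s hs y
  obtain ⟨hrate, hcont, hmild, hdiv⟩ := hP
  exact ⟨C₁, v₁, ϖ, H, ⟨hrate, hcont, hmild, hdiv⟩, ⟨hsw₁, hwg₁, hI₁⟩, hsing₁,
    fun s hs y => inner_curl_nonneg_of_fading hν hT hsol hrate hcont hmild hdiv hμpos hμ0 hzoom hfade s hs y⟩

end Summit.NavierStokesRegularity.NavierStokesRegularity.Theorems

end
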